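import Literature.MathematicalPhysics.QuantumManyBody.PeriodicBoseGasScattering

/-!
# Crux `BoundaryTransferWeak` (stmt-AtomisticToContinuum-0827), line `Sketch`
# (idea `coupled-bath-relocation`): stub `stub_freeOneBodyApprox` — the cut-off sine

Pointwise one-dimensional calculus for the free one-body approximants of the sine mode
(`BECInsertionCorrectorBoundaryTransferWeakFreeOneBodyApprox.lean`): the smooth two-sided
cutoff `χ_τ(t) = S(t/τ) S((L-t)/τ)` of `(0, L)` (`S = Real.smoothTransition`) and the cut-off
sine `g_τ(t) = sin(πt/L) χ_τ(t)` — smooth on `ℝ`, vanishing (with its derivative) off `(0, L)`,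
equal to `sin(πt/L)` on `[τ, L-τ]`, `|g_τ| ≤ |sin|`, and `|g_τ'| ≤ (π/L)(1 + 2C)` on the two ends
`[0, τ] ∪ [L-τ, L]` for any bound `C` of `|S'|`. All [folklore].
-/

noncomputable section

namespace Summit.AtomisticToContinuum.BoseEinsteinCondensation.CoupledBaths

open Literature.MathematicalPhysics.QuantumManyBody.BoseGas MeasureTheory Filter Topology Set
open scoped ENNReal NNReal

namespace FreeOneBodyApprox

/-! ### The smooth two-sided cutoff and the cut-off sine -/

/-- The smooth two-sided cutoff `χ(t) = S(t/τ)·S((L-t)/τ)` of the interval `(0, L)` at scale `τ`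
(`S = Real.smoothTransition`). [folklore] -/
def cut (L τ t : ℝ) : ℝ :=
  Real.smoothTransition (t / τ) * Real.smoothTransition ((L - t) / τ)

/-- The derivative of `cut L τ`. [folklore] -/
def dcut (L τ t : ℝ) : ℝ :=
  deriv Real.smoothTransition (t / τ) / τ * Real.smoothTransition ((L - t) / τ) +
    Real.smoothTransition (t / τ) * (-(deriv Real.smoothTransition ((L - t) / τ) / τ))

/-- The cut-off sine `g(t) = sin(π t / L)·χ(t)`. [folklore] -/
def gcut (L τ t : ℝ) : ℝ := Real.sin (Real.pi * t / L) * cut L τ t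

/-- The derivative of `gcut L τ`. [folklore] -/
def dgcut (L τ t : ℝ) : ℝ :=
  Real.pi / L * Real.cos (Real.pi * t / L) * cut L τ t + Real.sin (Real.pi * t / L) * dcut L τ t

variable {L τ : ℝ}

/-- `χ` is smooth. [folklore] -/
theorem contDiff_cut (L τ : ℝ) {n : ℕ∞} : ContDiff ℝ n (cut L τ) :=
  (Real.smoothTransition.contDiff.comp (contDiff_id.div_const τ)).mul
    (Real.smoothTransition.contDiff.comp ((contDiff_const.sub contDiff_id).div_const τ))

/-- `g` is smooth. [folklore] -/
theorem contDiff_gcut (L τ : ℝ) {n : ℕ∞} : ContDiff ℝ n (gcut L τ) :=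
  (Real.contDiff_sin.comp ((contDiff_const.mul contDiff_id).div_const L)).mul (contDiff_cut L τ)

/-- `χ' = dcut`. [folklore] -/
theorem hasDerivAt_cut (L τ t : ℝ) : HasDerivAt (cut L τ) (dcut L τ t) t := by
  have hS : ∀ y, HasDerivAt Real.smoothTransition (deriv Real.smoothTransition y) y := fun y =>
    ((Real.smoothTransition.contDiff (n := 1)).differentiable (by simp) y).hasDerivAt
  have h1 : HasDerivAt (fun t => Real.smoothTransition (t / τ))
      (deriv Real.smoothTransition (t / τ) / τ) t := by
    refine ((hS (t / τ)).comp t ((hasDerivAt_id t).div_const τ)).congr_deriv ?_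
    ring
  have h2 : HasDerivAt (fun t => Real.smoothTransition ((L - t) / τ))
      (-(deriv Real.smoothTransition ((L - t) / τ) / τ)) t := by
    refine ((hS ((L - t) / τ)).comp t
      (((hasDerivAt_const t L).sub (hasDerivAt_id t)).div_const τ)).congr_deriv ?_
    ring
  exact h1.mul h2

/-- `g' = dgcut`. [folklore] -/
theorem hasDerivAt_gcut (L τ t : ℝ) : HasDerivAt (gcut L τ) (dgcut L τ t) t := by
  have h1 : HasDerivAt (fun t => Real.sin (Real.pi * t / L))
      (Real.pi / L * Real.cos (Real.pi * t / L)) t := by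
    refine ((Real.hasDerivAt_sin (Real.pi * t / L)).comp t
      (((hasDerivAt_id t).const_mul Real.pi).div_const L)).congr_deriv ?_
    simp only [mul_one]
    ring
  exact h1.mul (hasDerivAt_cut L τ t)

/-- `0 ≤ χ`. [folklore] -/
theorem cut_nonneg (L τ t : ℝ) : 0 ≤ cut L τ t :=
  mul_nonneg (Real.smoothTransition.nonneg _) (Real.smoothTransition.nonneg _)

/-- `χ ≤ 1`. [folklore] -/
theorem cut_le_one (L τ t : ℝ) : cut L τ t ≤ 1 :=
  mul_le_one₀ (Real.smoothTransition.le_one _) (Real.smoothTransition.nonneg _)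
    (Real.smoothTransition.le_one _)

/-- `χ = 0` to the left of `0`. [folklore] -/
theorem cut_eq_zero_of_nonpos (hτ : 0 < τ) {t : ℝ} (ht : t ≤ 0) : cut L τ t = 0 := by
  simp [cut, Real.smoothTransition.zero_of_nonpos (div_nonpos_of_nonpos_of_nonneg ht hτ.le)]

/-- `χ = 0` to the right of `L`. [folklore] -/
theorem cut_eq_zero_of_le (hτ : 0 < τ) {t : ℝ} (ht : L ≤ t) : cut L τ t = 0 := by
  simp [cut, Real.smoothTransition.zero_of_nonpos
    (div_nonpos_of_nonpos_of_nonneg (sub_nonpos.2 ht) hτ.le)]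

/-- `χ = 1` on `[τ, L - τ]`. [folklore] -/
theorem cut_eq_one (hτ : 0 < τ) {t : ℝ} (h1 : τ ≤ t) (h2 : t ≤ L - τ) : cut L τ t = 1 := by
  rw [cut, Real.smoothTransition.one_of_one_le ((one_le_div hτ).2 h1),
    Real.smoothTransition.one_of_one_le ((one_le_div hτ).2 (by linarith)), mul_one]

/-- `χ' = 0` to the left of `0`. [folklore] -/
theorem dcut_eq_zero_of_nonpos (hτ : 0 < τ) {t : ℝ} (ht : t ≤ 0) : dcut L τ t = 0 := by
  have h : t / τ ≤ 0 := div_nonpos_of_nonpos_of_nonneg ht hτ.le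
  simp [dcut, Real.smoothTransition.zero_of_nonpos h, deriv_smoothTransition_of_nonpos h]

/-- `χ' = 0` to the right of `L`. [folklore] -/
theorem dcut_eq_zero_of_le (hτ : 0 < τ) {t : ℝ} (ht : L ≤ t) : dcut L τ t = 0 := by
  have h : (L - t) / τ ≤ 0 := div_nonpos_of_nonpos_of_nonneg (sub_nonpos.2 ht) hτ.le
  simp [dcut, Real.smoothTransition.zero_of_nonpos h, deriv_smoothTransition_of_nonpos h]

/-- `χ' = 0` on `[τ, L - τ]`. [folklore] -/
theorem dcut_eq_zero_mid (hτ : 0 < τ) {t : ℝ} (h1 : τ ≤ t) (h2 : t ≤ L - τ) : dcut L τ t = 0 := by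
  have ha : 1 ≤ t / τ := (one_le_div hτ).2 h1
  have hb : 1 ≤ (L - t) / τ := (one_le_div hτ).2 (by linarith)
  simp [dcut, deriv_smoothTransition_of_one_le ha, deriv_smoothTransition_of_one_le hb]

/-- `|χ'| ≤ 2C/τ` for a bound `C` of `|S'|`. [folklore] -/
theorem abs_dcut_le (hτ : 0 < τ) {C : ℝ} (hC : ∀ y, |deriv Real.smoothTransition y| ≤ C) (t : ℝ) :
    |dcut L τ t| ≤ 2 * C / τ := by
  have hC0 : 0 ≤ C := (abs_nonneg _).trans (hC 0)
  unfold dcut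
  refine (abs_add_le _ _).trans ?_
  rw [abs_mul, abs_mul, abs_neg, abs_div, abs_div, abs_of_pos hτ,
    abs_of_nonneg (Real.smoothTransition.nonneg _), abs_of_nonneg (Real.smoothTransition.nonneg _)]
  have h1 : |deriv Real.smoothTransition (t / τ)| / τ * Real.smoothTransition ((L - t) / τ) ≤ C / τ :=
    calc _ ≤ C / τ * 1 := mul_le_mul (div_le_div_of_nonneg_right (hC _) hτ.le)
          (Real.smoothTransition.le_one _) (Real.smoothTransition.nonneg _) (div_nonneg hC0 hτ.le)
      _ = C / τ := mul_one _
  have h2 : Real.smoothTransition (t / τ) * (|deriv Real.smoothTransition ((L - t) / τ)| / τ) ≤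
      C / τ :=
    calc _ ≤ 1 * (C / τ) := mul_le_mul (Real.smoothTransition.le_one _)
          (div_le_div_of_nonneg_right (hC _) hτ.le) (div_nonneg (abs_nonneg _) hτ.le) zero_le_one
      _ = C / τ := one_mul _
  calc _ ≤ C / τ + C / τ := add_le_add h1 h2
    _ = 2 * C / τ := by ring

/-! ### Pointwise facts about the cut-off sine -/

/-- `g = 0` off `(0, L)`. [folklore] -/
theorem gcut_eq_zero (hτ : 0 < τ) {t : ℝ} (ht : t ∉ Ioo 0 L) : gcut L τ t = 0 := by
  rcases not_and_or.1 ht with h | h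
  · simp [gcut, cut_eq_zero_of_nonpos hτ (not_lt.1 h)]
  · simp [gcut, cut_eq_zero_of_le hτ (not_lt.1 h)]

/-- `g' = 0` off `(0, L)`. [folklore] -/
theorem dgcut_eq_zero (hτ : 0 < τ) {t : ℝ} (ht : t ∉ Ioo 0 L) : dgcut L τ t = 0 := by
  rcases not_and_or.1 ht with h | h
  · simp [dgcut, cut_eq_zero_of_nonpos hτ (not_lt.1 h), dcut_eq_zero_of_nonpos hτ (not_lt.1 h)]
  · simp [dgcut, cut_eq_zero_of_le hτ (not_lt.1 h), dcut_eq_zero_of_le hτ (not_lt.1 h)]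

/-- `g = sin(π·/L)` on `[τ, L - τ]`. [folklore] -/
theorem gcut_eq_sin (hτ : 0 < τ) {t : ℝ} (h1 : τ ≤ t) (h2 : t ≤ L - τ) :
    gcut L τ t = Real.sin (Real.pi * t / L) := by
  rw [gcut, cut_eq_one hτ h1 h2, mul_one]

/-- `g' = (π/L) cos(π·/L)` on `[τ, L - τ]`. [folklore] -/
theorem dgcut_eq_cos (hτ : 0 < τ) {t : ℝ} (h1 : τ ≤ t) (h2 : t ≤ L - τ) :
    dgcut L τ t = Real.pi / L * Real.cos (Real.pi * t / L) := by
  rw [dgcut, cut_eq_one hτ h1 h2, dcut_eq_zero_mid hτ h1 h2, mul_one, mul_zero, add_zero]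

/-- `|g| ≤ |sin(π·/L)|`. [folklore] -/
theorem abs_gcut_le (L τ t : ℝ) : |gcut L τ t| ≤ |Real.sin (Real.pi * t / L)| := by
  rw [gcut, abs_mul, abs_of_nonneg (cut_nonneg L τ t)]
  exact mul_le_of_le_one_right (abs_nonneg _) (cut_le_one L τ t)

/-- `g² ≤ sin²(π·/L)`. [folklore] -/
theorem gcut_sq_le (L τ t : ℝ) : gcut L τ t ^ 2 ≤ Real.sin (Real.pi * t / L) ^ 2 :=
  sq_le_sq.2 (abs_gcut_le L τ t)

/-- `(g - sin)² ≤ 1`. [folklore] -/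
theorem gcut_sub_sin_sq_le_one (L τ t : ℝ) :
    (gcut L τ t - Real.sin (Real.pi * t / L)) ^ 2 ≤ 1 := by
  have h : gcut L τ t - Real.sin (Real.pi * t / L) =
      -(Real.sin (Real.pi * t / L) * (1 - cut L τ t)) := by
    rw [gcut]; ring
  rw [h, neg_sq, mul_pow]
  have h1 : Real.sin (Real.pi * t / L) ^ 2 ≤ 1 := by
    rw [sq_le_one_iff_abs_le_one]; exact Real.abs_sin_le_one _
  have h2 : (1 - cut L τ t) ^ 2 ≤ 1 := by
    rw [sq_le_one_iff_abs_le_one, abs_le]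
    constructor <;> linarith [cut_nonneg L τ t, cut_le_one L τ t]
  calc _ ≤ (1 : ℝ) * 1 := mul_le_mul h1 h2 (sq_nonneg _) zero_le_one
    _ = 1 := mul_one _

/-- For `t ∈ [0, τ]` (`τ ≤ L`), `|sin(π t / L)| ≤ π τ / L`. [folklore] -/
theorem abs_sin_le_left (hL : 0 < L) (hτL : τ ≤ L) {t : ℝ} (h0 : 0 ≤ t) (h1 : t ≤ τ) :
    |Real.sin (Real.pi * t / L)| ≤ Real.pi * τ / L := by
  have hx : 0 ≤ Real.pi * t / L := by positivity
  have hxπ : Real.pi * t / L ≤ Real.pi := by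
    rw [div_le_iff₀ hL]; nlinarith [Real.pi_pos]
  rw [abs_of_nonneg ((Real.sin_nonneg_of_nonneg_of_le_pi hx hxπ))]
  exact (Real.sin_le hx).trans (by gcongr)

/-- For `t ∈ [L - τ, L]` (`τ ≤ L`), `|sin(π t / L)| ≤ π τ / L`. [folklore] -/
theorem abs_sin_le_right (hL : 0 < L) (hτL : τ ≤ L) {t : ℝ} (h0 : L - τ ≤ t) (h1 : t ≤ L) :
    |Real.sin (Real.pi * t / L)| ≤ Real.pi * τ / L := by
  have h := abs_sin_le_left (τ := τ) hL hτL (t := L - t) (by linarith) (by linarith)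
  have he : Real.pi * (L - t) / L = Real.pi - Real.pi * t / L := by field_simp
  rwa [he, Real.sin_pi_sub] at h

/-- On the two ends `[0, τ] ∪ [L - τ, L]`: `|g'| ≤ (π / L)(1 + 2C)`. [folklore] -/
theorem abs_dgcut_le_ends (hL : 0 < L) (hτ : 0 < τ) (hτL : τ ≤ L) {C : ℝ}
    (hC : ∀ y, |deriv Real.smoothTransition y| ≤ C) {t : ℝ}
    (ht : (0 ≤ t ∧ t ≤ τ) ∨ (L - τ ≤ t ∧ t ≤ L)) :
    |dgcut L τ t| ≤ Real.pi / L * (1 + 2 * C) := by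
  have hC0 : 0 ≤ C := (abs_nonneg _).trans (hC 0)
  have hsin : |Real.sin (Real.pi * t / L)| ≤ Real.pi * τ / L := by
    rcases ht with ⟨h0, h1⟩ | ⟨h0, h1⟩
    · exact abs_sin_le_left hL hτL h0 h1
    · exact abs_sin_le_right hL hτL h0 h1
  unfold dgcut
  refine (abs_add_le _ _).trans ?_
  have h1 : |Real.pi / L * Real.cos (Real.pi * t / L) * cut L τ t| ≤ Real.pi / L := by
    rw [abs_mul, abs_mul, abs_of_pos (div_pos Real.pi_pos hL), abs_of_nonneg (cut_nonneg L τ t)]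
    calc _ ≤ Real.pi / L * 1 * 1 := by
          gcongr
          · exact cut_nonneg L τ t
          · exact Real.abs_cos_le_one _
          · exact cut_le_one L τ t
      _ = Real.pi / L := by ring
  have h2 : |Real.sin (Real.pi * t / L) * dcut L τ t| ≤ Real.pi / L * (2 * C) := by
    rw [abs_mul]
    calc _ ≤ Real.pi * τ / L * (2 * C / τ) :=
          mul_le_mul hsin (abs_dcut_le hτ hC t) (abs_nonneg _) (by positivity)
      _ = Real.pi / L * (2 * C) := by field_simp
  calc _ ≤ Real.pi / L + Real.pi / L * (2 * C) := add_le_add h1 h2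
    _ = _ := by ring

end FreeOneBodyApprox

/-- **The cut-off sine profile** (registered anchor of this helper file): for `0 < τ ≤ L` and any
bound `C` of `|S'|` there is a `C¹` profile `g` with derivative `dg`, both vanishing off `(0, L)`,
with `g = sin(π·/L)`, `dg = (π/L) cos(π·/L)` on `[τ, L - τ]`, `|g| ≤ |sin(π·/L)|` everywhere and
`|dg| ≤ (π/L)(1 + 2C)` on the two ends — namely `g = gcut L τ`. [folklore] -/
theorem freeOneBodyApprox_cutoffProfile :
    ∀ (L τ C : ℝ), 0 < L → 0 < τ → τ ≤ L → (∀ y : ℝ, |deriv Real.smoothTransition y| ≤ C) →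
      ∃ g dg : ℝ → ℝ, ContDiff ℝ 1 g ∧ (∀ t : ℝ, HasDerivAt g (dg t) t) ∧
        (∀ t : ℝ, t ∉ Set.Ioo 0 L → g t = 0 ∧ dg t = 0) ∧
        (∀ t : ℝ, τ ≤ t → t ≤ L - τ →
          g t = Real.sin (Real.pi * t / L) ∧ dg t = Real.pi / L * Real.cos (Real.pi * t / L)) ∧
        (∀ t : ℝ, |g t| ≤ |Real.sin (Real.pi * t / L)|) ∧
        ∀ t : ℝ, (0 ≤ t ∧ t ≤ τ) ∨ (L - τ ≤ t ∧ t ≤ L) → |dg t| ≤ Real.pi / L * (1 + 2 * C) := by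
  intro L τ C hL hτ hτL hC
  open FreeOneBodyApprox in
  exact ⟨gcut L τ, dgcut L τ, contDiff_gcut L τ, hasDerivAt_gcut L τ,
    fun t ht => ⟨gcut_eq_zero hτ ht, dgcut_eq_zero hτ ht⟩,
    fun t h1 h2 => ⟨gcut_eq_sin hτ h1 h2, dgcut_eq_cos hτ h1 h2⟩, abs_gcut_le L τ,
    fun t ht => abs_dgcut_le_ends hL hτ hτL hC ht⟩

end Summit.AtomisticToContinuum.BoseEinsteinCondensation.CoupledBaths

end
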